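import Mathlib.CategoryTheory.Comma.Over.Basic
import Mathlib.CategoryTheory.Limits.Shapes.IsTerminal
import Mathlib.CategoryTheory.Limits.Shapes.BinaryProducts
import Mathlib.CategoryTheory.Limits.Shapes.FiniteProducts
import Mathlib.CategoryTheory.Limits.Shapes.Countable
import Mathlib.CategoryTheory.Limits.FormalCoproducts.Basic
import Mathlib.CategoryTheory.Endomorphism
import Mathlib.CategoryTheory.Skeletal
import Mathlib.CategoryTheory.IsConnected
import Mathlib.CategoryTheory.EpiMono
import Mathlib.CategoryTheory.ObjectProperty.FullSubcategory
import Mathlib.CategoryTheory.Action.Continuous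
import Mathlib.CategoryTheory.FintypeCat
import Mathlib.Topology.Category.FinTopCat
import Mathlib.Topology.Algebra.Group.Basic
import Mathlib.Algebra.Group.Subgroup.Basic
import HarnessLib

/-!
# Frobenioids I, §0: the category-theoretic dictionary, part 1 (STEP-0 calibration fragment)

Mochizuki, *The geometry of Frobenioids I: the general theory*, Kyushu J. Math. **62** (2008)
293–400, §0 "Notations and Conventions", paragraphs **Topological Groups** and **Categories**,
kurims text pp. 13–16 [cite: MochizukiFrdI2008, §0 pp.13-16]: the vocabulary (slim profinite
groups, `B(Π)`, slices, FSM-morphisms, sub-automorphisms and `Aut`-saturation, rigid functors and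
slim categories, `0`- and `1`-commutativity, skeleta, connected / mobile / quasi-connected objects,
totally and almost totally epimorphic categories, categories of finitely / countably connected
type, `C⁰`, `C^⊥`, `C^⊤`, connected categories) together with the claims printed on those pages:

* composites of FSM-morphisms are FSM-morphisms (p. 14);
* `Aut_C(A) ⊆ Aut^sub_C(A)` (p. 14);
* when the composites are rigid, a `1`-commutative diagram has a *unique* witnessing isomorphism
  (p. 15);
* connected objects are quasi-connected (p. 15);
* in a category of finitely (resp. countably) connected type every nonempty object is mobile, so a
  nonempty object is connected iff it is quasi-connected (p. 15);
* a mobile object all of whose incoming arrows with nonempty domain are epimorphisms is connected;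
  hence in a totally epimorphic category every object is quasi-connected (p. 15);
* in a totally epimorphic category, if `α ∘ β` is an isomorphism then so are `α` and `β` (p. 16).

Mathlib already IS much of this vocabulary and we only record the dictionary: `C_A = Over A`,
`^A C = Under A`, `(j_A)_! = Over.forget A`, `f_! = Over.map f`, `End_C(A) = End A`,
`Aut_C(A) = Aut A`, skeleton = `Skeletal` / `Skeleton`, `C^⊥`/`C^⊤` = full subcategories of
`Limits.FormalCoproduct C` (whose `Hom` is literally the displayed formula
`Hom(∐ Aᵢ, ∐ Bⱼ) = ∏ᵢ ∐ⱼ Hom(Aᵢ, Bⱼ)` of p. 16), connected category = `IsConnected`.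

Deliberately NOT here (listed for the calibration record): the equivalences
`(C^⊥)⁰ ≃ C`, `(D⁰)^⊥ ≃ D` and the statements "`C^⊥` is of finitely connected type",
"`C` totally epimorphic ⇒ `C^⊥` almost totally epimorphic" (p. 16), and the cited external fact
"`Π` is slim iff `B(Π)` is slim" ([GeoAn] Cor. 1.1.6); pp. 17–18 are in the companion file
`CategoriesFactorization.lean`. No statement of the paper is strengthened.
-/

namespace Literature.AlgebraicGeometry.Frobenioids

open CategoryTheory CategoryTheory.Limits

universe w v v₁ v₂ v₃ v₄ u u₁ u₂ u₃ u₄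

/-! ### Topological groups (p. 13) -/

section TopologicalGroups

/-- A topological group `Π` is *slim* if the centraliser `Z_Π(H)` of every open subgroup
`H ⊆ Π` is trivial (FrdI §0 p. 13, stated there for profinite `Π`).
[cite: MochizukiFrdI2008, §0 p.13] -/
@[mk_iff] structure IsSlimGroup (G : Type u) [Group G] [TopologicalSpace G] : Prop where
  /-- centralisers of open subgroups are trivial -/
  centralizer_eq_bot : ∀ H : Subgroup G, IsOpen (H : Set G) → Subgroup.centralizer (H : Set G) = ⊥

open scoped FintypeCatDiscrete in
/-- `B(Π)`: the category of finite sets with a continuous `Π`-action and `Π`-equivariant maps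
(FrdI §0 p. 13: "a Galois category, or, in the terminology of [GeoAn], a connected anabelioid"),
realised as Mathlib's `ContAction FintypeCat Π`. [cite: MochizukiFrdI2008, §0 p.13] -/
abbrev BCat (G : Type u) [Group G] [TopologicalSpace G] := ContAction FintypeCat.{u} G

end TopologicalGroups

/-! ### Categories: slices, terminal objects, FSM-morphisms (pp. 13–14) -/

section Categories

variable {C : Type u} [Category.{v} C]

variable (C) in
/-- A *one-object category*: a category with precisely one object (FrdI §0 p. 13).
[cite: MochizukiFrdI2008, §0 p.13] -/
@[mk_iff] structure IsOneObject : Prop where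
  /-- there is an object to which every object is equal -/
  exists_eq : ∃ A : C, ∀ B : C, B = A

variable (C) in
/-- A *one-morphism category*: a category with precisely one morphism, necessarily the identity of
its unique object (FrdI §0 p. 13). [cite: MochizukiFrdI2008, §0 p.13] -/
@[mk_iff] structure IsOneMorphism : Prop where
  /-- one object whose only endomorphism is the identity -/
  exists_eq : ∃ A : C, (∀ B : C, B = A) ∧ ∀ f : A ⟶ A, f = 𝟙 A

/-- "Thus, a one-morphism category is always a one-object category" (FrdI §0 p. 13).
[cite: MochizukiFrdI2008, §0 p.13] -/
theorem IsOneMorphism.isOneObject (h : IsOneMorphism C) : IsOneObject C := by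
  obtain ⟨A, hA, -⟩ := h.exists_eq
  exact ⟨⟨A, hA⟩⟩

/-- `C_A` (FrdI §0 p. 13): objects are arrows `B → A`, morphisms are `A`-morphisms — Mathlib's
`Over A`. [cite: MochizukiFrdI2008, §0 p.13] -/
abbrev sliceOver (A : C) := Over A

/-- `^A C` (FrdI §0 p. 13): objects are arrows `A → B` — Mathlib's `Under A`.
[cite: MochizukiFrdI2008, §0 p.13] -/
abbrev sliceUnder (A : C) := Under A

/-- `(j_A)_! : C_A → C`, forgetting the structure morphism (FrdI §0 p. 13) — `Over.forget A`.
[cite: MochizukiFrdI2008, §0 p.13] -/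
abbrev forgetSlice (A : C) : Over A ⥤ C := Over.forget A

/-- `f_! : C_A → C_B` for `f : A → B`, post-composition (FrdI §0 pp. 13–14) — `Over.map f`.
[cite: MochizukiFrdI2008, §0 p.14] -/
abbrev pushSlice {A B : C} (f : A ⟶ B) : Over A ⥤ Over B := Over.map f

/-- `A` is *terminal* if every object admits a unique arrow to `A` (FrdI §0 p. 14); as a
proposition, `Nonempty (IsTerminal A)`. [cite: MochizukiFrdI2008, §0 p.14] -/
def IsTerminalObj (A : C) : Prop := Nonempty (IsTerminal A)

/-- `A` is *pseudo-terminal* if every object admits a (not necessarily unique) arrow to `A`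
(FrdI §0 p. 14). [cite: MochizukiFrdI2008, §0 p.14] -/
def IsPseudoTerminal (A : C) : Prop := ∀ B : C, Nonempty (B ⟶ A)

/-- Terminal objects are pseudo-terminal. [cite: MochizukiFrdI2008, §0 p.14] -/
theorem IsTerminalObj.isPseudoTerminal {A : C} (h : IsTerminalObj A) : IsPseudoTerminal A :=
  fun B => ⟨h.some.from B⟩

/-- `β : B → A` is *fiberwise-surjective* if every `γ : X → A` can be completed to a commutative
square `β ∘ δ_B = γ ∘ δ_X` (FrdI §0 p. 14). (Two arrows are *co-objective* when they share domain
and codomain — automatic in the typed setting.) [cite: MochizukiFrdI2008, §0 p.14] -/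
def IsFiberwiseSurjective {B A : C} (β : B ⟶ A) : Prop :=
  ∀ ⦃X : C⦄ (γ : X ⟶ A), ∃ (D : C) (δB : D ⟶ B) (δX : D ⟶ X), δB ≫ β = δX ≫ γ

/-- An *FSM-morphism*: a fiberwise-surjective monomorphism (FrdI §0 p. 14).
[cite: MochizukiFrdI2008, §0 p.14] -/
def IsFSM {B A : C} (β : B ⟶ A) : Prop := IsFiberwiseSurjective β ∧ Mono β

/-- "One verifies immediately that every composite of FSM-morphisms is again an FSM-morphism"
(FrdI §0 p. 14). [cite: MochizukiFrdI2008, §0 p.14] -/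
theorem IsFSM.comp {X Y Z : C} {f : X ⟶ Y} {g : Y ⟶ Z} (hf : IsFSM f) (hg : IsFSM g) :
    IsFSM (f ≫ g) := by
  haveI := hf.2
  haveI := hg.2
  refine ⟨fun W γ => ?_, mono_comp f g⟩
  obtain ⟨D', δY, δW, h₁⟩ := hg.1 γ
  obtain ⟨D, δX, δD', h₂⟩ := hf.1 δY
  refine ⟨D, δX, δD' ≫ δW, ?_⟩
  rw [← Category.assoc, h₂, Category.assoc, h₁, Category.assoc]

variable (C) in
/-- A *category of FSM-type*: every FSM-morphism is an isomorphism (FrdI §0 p. 14).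
[cite: MochizukiFrdI2008, §0 p.14] -/
@[mk_iff] structure IsOfFSMType : Prop where
  /-- FSM-morphisms are isomorphisms -/
  isIso_of_isFSM : ∀ {A B : C} (f : A ⟶ B), IsFSM f → IsIso f

/-! ### Endomorphisms, sub-automorphisms, `Aut`-saturation (p. 14) -/

/-- `End_C(A)` is Mathlib's `End A`; `Aut_C(A)` is `Aut A` (FrdI §0 p. 14). An endomorphism `α`
of `A` is a *sub-automorphism* if `φ ∘ β = α ∘ φ` for some arrow `φ : B → A` and some
automorphism `β` of `B`. [cite: MochizukiFrdI2008, §0 p.14] -/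
def IsSubAutomorphism {A : C} (α : A ⟶ A) : Prop :=
  ∃ (B : C) (φ : B ⟶ A) (β : B ≅ B), β.hom ≫ φ = φ ≫ α

/-- `Aut^sub_C(A) ⊆ End_C(A)`, the set of sub-automorphisms (FrdI §0 p. 14).
[cite: MochizukiFrdI2008, §0 p.14] -/
def autSub (A : C) : Set (A ⟶ A) := {α | IsSubAutomorphism α}

/-- `Aut_C(A) ⊆ Aut^sub_C(A)` (FrdI §0 p. 14): take `φ = id`. [cite: MochizukiFrdI2008, §0 p.14] -/
theorem mem_autSub_of_isIso {A : C} (α : A ⟶ A) [IsIso α] : α ∈ autSub A :=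
  ⟨A, 𝟙 A, asIso α, by simp⟩

/-- `A` is *`Aut`-saturated*: `Aut_C(A) = Aut^sub_C(A)` (FrdI §0 p. 14).
[cite: MochizukiFrdI2008, §0 p.14] -/
def IsAutSaturatedObj (A : C) : Prop := ∀ α ∈ autSub A, IsIso α

/-- `A` is *`Aut^sub`-saturated*: `Aut^sub_C(A) = End_C(A)` (FrdI §0 p. 14).
[cite: MochizukiFrdI2008, §0 p.14] -/
def IsAutSubSaturatedObj (A : C) : Prop := ∀ α : A ⟶ A, α ∈ autSub A

/-- `A` is *of `Aut`-type*: `Aut_C(A) = End_C(A)` (FrdI §0 p. 14).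
[cite: MochizukiFrdI2008, §0 p.14] -/
def IsOfAutTypeObj (A : C) : Prop := ∀ α : A ⟶ A, IsIso α

variable (C) in
/-- `C` is `Aut`-saturated if every object is (FrdI §0 p. 14). [cite: MochizukiFrdI2008, §0 p.14] -/
@[mk_iff] structure IsAutSaturated : Prop where
  /-- every object is `Aut`-saturated -/
  obj : ∀ A : C, IsAutSaturatedObj A

variable (C) in
/-- `C` is `Aut^sub`-saturated if every object is (FrdI §0 p. 14).
[cite: MochizukiFrdI2008, §0 p.14] -/
@[mk_iff] structure IsAutSubSaturated : Prop where
  /-- every object is `Aut^sub`-saturated -/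
  obj : ∀ A : C, IsAutSubSaturatedObj A

variable (C) in
/-- `C` is of `Aut`-type if every object is (FrdI §0 p. 14). [cite: MochizukiFrdI2008, §0 p.14] -/
@[mk_iff] structure IsOfAutType : Prop where
  /-- every object is of `Aut`-type -/
  obj : ∀ A : C, IsOfAutTypeObj A

/-- Of `Aut`-type implies `Aut`-saturated and `Aut^sub`-saturated (immediate from the chain
`Aut ⊆ Aut^sub ⊆ End`, p. 14). [cite: MochizukiFrdI2008, §0 p.14] -/
theorem IsOfAutTypeObj.isAutSaturatedObj_and {A : C} (h : IsOfAutTypeObj A) :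
    IsAutSaturatedObj A ∧ IsAutSubSaturatedObj A :=
  ⟨fun α _ => h α, fun α => by haveI := h α; exact mem_autSub_of_isIso α⟩

/-- An arrow `A → B` is an *`End`-equivalence* if there exists an arrow `B → A` (FrdI §0 p. 14).
[cite: MochizukiFrdI2008, §0 p.14] -/
def IsEndEquivalence {A B : C} (_f : A ⟶ B) : Prop := Nonempty (B ⟶ A)

/-! ### Functors: rigidity, slimness, `0`- and `1`-commutativity (pp. 14–15) -/

variable {C₁ : Type u₁} [Category.{v₁} C₁] {C₂ : Type u₂} [Category.{v₂} C₂]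
  {C₃ : Type u₃} [Category.{v₃} C₃] {C₄ : Type u₄} [Category.{v₄} C₄]

/-- An *isomorphism between functors* is a natural transformation all of whose components are
isomorphisms, i.e. an `Iso` in the functor category; `Aut(φ)`/`End(φ)` are `Aut φ`/`End φ` there.
A functor `φ` is *rigid* if `Aut(φ)` is trivial (FrdI §0 p. 14). [cite: MochizukiFrdI2008, §0 p.14] -/
def IsRigidFunctor (φ : C₁ ⥤ C₂) : Prop := ∀ α : φ ≅ φ, α = Iso.refl φ

variable (C) in
/-- A category is *slim* if the natural functor `C_A → C` is rigid for every object `A`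
(FrdI §0 p. 14). [cite: MochizukiFrdI2008, §0 p.14] -/
@[mk_iff] structure IsSlim : Prop where
  /-- all the forgetful functors from slices are rigid -/
  isRigid_forget : ∀ A : C, IsRigidFunctor (Over.forget A)

/-- A square of functors *`1`-commutes* if the two composites are isomorphic (FrdI §0 p. 15).
[cite: MochizukiFrdI2008, §0 p.15] -/
def OneCommutes (F : C₁ ⥤ C₂) (G : C₂ ⥤ C₄) (H : C₁ ⥤ C₃) (K : C₃ ⥤ C₄) : Prop :=
  Nonempty (F ⋙ G ≅ H ⋙ K)

/-- A square of functors *`0`-commutes* if it "commutes in the literal sense" (FrdI §0 p. 15).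
[cite: MochizukiFrdI2008, §0 p.15] -/
def ZeroCommutes (F : C₁ ⥤ C₂) (G : C₂ ⥤ C₄) (H : C₁ ⥤ C₃) (K : C₃ ⥤ C₄) : Prop :=
  F ⋙ G = H ⋙ K

/-- `0`-commutative squares `1`-commute. [cite: MochizukiFrdI2008, §0 p.15] -/
theorem ZeroCommutes.oneCommutes {F : C₁ ⥤ C₂} {G : C₂ ⥤ C₄} {H : C₁ ⥤ C₃} {K : C₃ ⥤ C₄}
    (h : ZeroCommutes F G H K) : OneCommutes F G H K := ⟨eqToIso h⟩

/-- "When a diagram in which the various composite functors are all rigid `1`-commutes, … any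
isomorphism between the composite functors in question is necessarily unique" (FrdI §0 p. 15).
[cite: MochizukiFrdI2008, §0 p.15] -/
theorem iso_unique_of_isRigidFunctor {Φ Ψ : C₁ ⥤ C₂} (hΦ : IsRigidFunctor Φ) (e e' : Φ ≅ Ψ) :
    e = e' := by
  have h := hΦ (e ≪≫ e'.symm)
  ext X
  have hX := congrArg (fun i : Φ ≅ Φ => i.hom.app X ≫ e'.hom.app X) h
  simpa using hX

/-! ### Skeleta (p. 15) -/

/-- A *skeleton*: any two isomorphic objects are equal (FrdI §0 p. 15) — Mathlib's `Skeletal C`;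
a *skeletal subcategory* is a full subcategory that is a skeleton and whose inclusion is an
equivalence. [cite: MochizukiFrdI2008, §0 p.15] -/
@[mk_iff] structure IsSkeletalSubcategory (P : ObjectProperty C) : Prop where
  /-- the full subcategory is a skeleton -/
  skeletal : Skeletal P.FullSubcategory
  /-- the (fully faithful) inclusion is essentially surjective, hence an equivalence -/
  essSurj : P.ι.EssSurj

/-- The inclusion of a skeletal subcategory is an equivalence of categories.
[cite: MochizukiFrdI2008, §0 p.15] -/
theorem IsSkeletalSubcategory.isEquivalence {P : ObjectProperty C} (h : IsSkeletalSubcategory P) :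
    P.ι.IsEquivalence :=
  haveI := h.essSurj
  {}

/-! ### Connected, mobile and quasi-connected objects; totally epimorphic categories (p. 15) -/

/-- `A` is *nonempty*, i.e. non-initial (FrdI §0 p. 15). [cite: MochizukiFrdI2008, §0 p.15] -/
def IsNonemptyObj (A : C) : Prop := IsEmpty (IsInitial A)

/-- A nonempty object is *connected* if it is not isomorphic to the coproduct of two nonempty
objects (FrdI §0 p. 15). Since colimit cocones are stable under isomorphisms of their points,
"`A ≅ B₁ ⊔ B₂`" is rendered as "some pair of arrows `B₁ → A ← B₂` is a coproduct diagram".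
[cite: MochizukiFrdI2008, §0 p.15] -/
def IsConnectedObj (A : C) : Prop :=
  IsNonemptyObj A ∧ ∀ (B₁ B₂ : C) (ι₁ : B₁ ⟶ A) (ι₂ : B₂ ⟶ A), IsNonemptyObj B₁ → IsNonemptyObj B₂ →
    IsEmpty (IsColimit (BinaryCofan.mk ι₁ ι₂))

/-- `A` is *mobile* if some `Hom_C(A, B)` has cardinality `≥ 2` (FrdI §0 p. 15).
[cite: MochizukiFrdI2008, §0 p.15] -/
def IsMobile (A : C) : Prop := ∃ (B : C) (f g : A ⟶ B), f ≠ g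

/-- `A` is *quasi-connected* if it is either immobile or connected (FrdI §0 p. 15).
[cite: MochizukiFrdI2008, §0 p.15] -/
def IsQuasiConnected (A : C) : Prop := ¬ IsMobile A ∨ IsConnectedObj A

/-- "Thus, connected objects are always quasi-connected" (FrdI §0 p. 15).
[cite: MochizukiFrdI2008, §0 p.15] -/
theorem IsConnectedObj.isQuasiConnected {A : C} (h : IsConnectedObj A) : IsQuasiConnected A :=
  Or.inr h

variable (C) in
/-- `C` is *totally epimorphic* if every morphism is an epimorphism (FrdI §0 p. 15).
[cite: MochizukiFrdI2008, §0 p.15] -/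
@[mk_iff] structure IsTotallyEpimorphic : Prop where
  /-- every arrow is epi -/
  epi : ∀ {A B : C} (f : A ⟶ B), Epi f

variable (C) in
/-- `C` is *almost totally epimorphic* if every morphism with nonempty domain and connected
codomain is an epimorphism (FrdI §0 p. 15). [cite: MochizukiFrdI2008, §0 p.15] -/
@[mk_iff] structure IsAlmostTotallyEpimorphic : Prop where
  /-- arrows from nonempty to connected objects are epi -/
  epi : ∀ {A B : C} (f : A ⟶ B), IsNonemptyObj A → IsConnectedObj B → Epi f

/-- Totally epimorphic categories are almost totally epimorphic. [cite: MochizukiFrdI2008, §0 p.15] -/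
theorem IsTotallyEpimorphic.isAlmostTotallyEpimorphic (h : IsTotallyEpimorphic C) :
    IsAlmostTotallyEpimorphic C :=
  ⟨fun f _ _ => h.epi f⟩

variable (C) in
/-- `C` is *of finitely connected type* (FrdI §0 p. 15): it has finite coproducts; every object is
a coproduct of finitely many connected objects; and for every finite coproduct `∐ Aᵢ` and every
connected `B` the natural map `∐ᵢ Hom(B, Aᵢ) → Hom(B, ∐ᵢ Aᵢ)` is bijective.
[cite: MochizukiFrdI2008, §0 p.15] -/
structure IsOfFinitelyConnectedType : Prop where
  /-- closed under finite coproducts -/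
  hasFiniteCoproducts : HasFiniteCoproducts C
  /-- every object is a finite coproduct of connected objects -/
  exists_cofan : ∀ A : C, ∃ (n : ℕ) (X : Fin n → C), (∀ i, IsConnectedObj (X i)) ∧
    ∃ c : Cofan X, Nonempty (IsColimit c) ∧ Nonempty (c.pt ≅ A)
  /-- connected objects see finite coproducts as disjoint unions of `Hom`-sets -/
  bijective : ∀ {n : ℕ} {X : Fin n → C} (c : Cofan X), IsColimit c → ∀ B : C, IsConnectedObj B →
    Function.Bijective fun p : Σ i, (B ⟶ X i) => p.2 ≫ c.inj p.1

variable (C) in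
/-- `C` is *of countably connected type* (FrdI §0 p. 15): the same three conditions with countable
index sets. [cite: MochizukiFrdI2008, §0 p.15] -/
structure IsOfCountablyConnectedType : Prop where
  /-- closed under countable coproducts -/
  hasCountableCoproducts : HasCountableCoproducts C
  /-- every object is a countable coproduct of connected objects -/
  exists_cofan : ∀ A : C, ∃ (ι : Type) (_ : Countable ι) (X : ι → C), (∀ i, IsConnectedObj (X i)) ∧
    ∃ c : Cofan X, Nonempty (IsColimit c) ∧ Nonempty (c.pt ≅ A)
  /-- connected objects see countable coproducts as disjoint unions of `Hom`-sets -/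
  bijective : ∀ {ι : Type} [Countable ι] {X : ι → C} (c : Cofan X), IsColimit c → ∀ B : C,
    IsConnectedObj B → Function.Bijective fun p : Σ i, (B ⟶ X i) => p.2 ≫ c.inj p.1

/-- The point of a colimit cofan over an empty index type is initial. [folklore] -/
private def isInitialOfIsEmpty {ι : Type w} [IsEmpty ι] {X : ι → C} {c : Cofan X}
    (hc : IsColimit c) : IsInitial c.pt :=
  IsInitial.ofUniqueHom (fun Y => hc.desc (Cofan.mk Y fun i => isEmptyElim i))
    fun _ _ => hc.hom_ext fun ⟨i⟩ => isEmptyElim i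

/-- An initial object is immobile, so a mobile object is nonempty. [cite: MochizukiFrdI2008, §0 p.15] -/
theorem IsMobile.isNonemptyObj {A : C} (h : IsMobile A) : IsNonemptyObj A := by
  refine ⟨fun hA => ?_⟩
  obtain ⟨B, f, g, hfg⟩ := h
  exact hfg (hA.hom_ext f g)

/-- Core of the mobility argument of p. 15: if connected objects see some coproduct `A ⊔ A` as a
disjoint union of `Hom`-sets, and a connected object maps to `A`, then the two coprojections
`A ⇉ A ⊔ A` differ, so `A` is mobile. [cite: MochizukiFrdI2008, §0 p.15] -/
theorem isMobile_of_cofan_pair {A B : C} (g : B ⟶ A) (c : Cofan fun _ : Fin 2 => A)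
    (hinj : Function.Injective fun p : Σ _ : Fin 2, (B ⟶ A) => p.2 ≫ c.inj p.1) : IsMobile A := by
  refine ⟨c.pt, c.inj 0, c.inj 1, fun h => ?_⟩
  have h01 : (0 : Fin 2) = 1 := congrArg Sigma.fst (@hinj ⟨0, g⟩ ⟨1, g⟩ (by simp only [h]))
  exact absurd h01 (by decide)

/-- "If `C` is of finitely … connected type, then every nonempty object of `C` is mobile"
(FrdI §0 p. 15). [cite: MochizukiFrdI2008, §0 p.15] -/
theorem IsOfFinitelyConnectedType.isMobile (hC : IsOfFinitelyConnectedType C) {A : C}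
    (hA : IsNonemptyObj A) : IsMobile A := by
  haveI := hC.hasFiniteCoproducts
  obtain ⟨n, X, hX, c, ⟨hc⟩, ⟨e⟩⟩ := hC.exists_cofan A
  -- `n ≠ 0`, else `A` would be initial
  rcases Nat.eq_zero_or_pos n with rfl | hn
  · exact (hA.false (IsInitial.ofIso (isInitialOfIsEmpty hc) e)).elim
  · set i₀ : Fin n := ⟨0, hn⟩
    let g : X i₀ ⟶ A := c.inj i₀ ≫ e.hom
    let c₂ : Cofan (fun _ : Fin 2 => A) := Cofan.mk (∐ fun _ : Fin 2 => A) (Sigma.ι _)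
    exact isMobile_of_cofan_pair g c₂ (hC.bijective c₂ (coproductIsCoproduct _) (X i₀) (hX i₀)).1

/-- "If `C` is of … countably connected type, then every nonempty object of `C` is mobile"
(FrdI §0 p. 15). [cite: MochizukiFrdI2008, §0 p.15] -/
theorem IsOfCountablyConnectedType.isMobile (hC : IsOfCountablyConnectedType C) {A : C}
    (hA : IsNonemptyObj A) : IsMobile A := by
  haveI := hC.hasCountableCoproducts
  obtain ⟨ι, hι, X, hX, c, ⟨hc⟩, ⟨e⟩⟩ := hC.exists_cofan A
  rcases isEmpty_or_nonempty ι with hι' | ⟨⟨i₀⟩⟩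
  · exact (hA.false (IsInitial.ofIso (isInitialOfIsEmpty hc) e)).elim
  · let g : X i₀ ⟶ A := c.inj i₀ ≫ e.hom
    haveI : HasCoproductsOfShape (Fin 2) C := HasCountableCoproducts.out _
    let c₂ : Cofan (fun _ : Fin 2 => A) := Cofan.mk (∐ fun _ : Fin 2 => A) (Sigma.ι _)
    exact isMobile_of_cofan_pair g c₂ (hC.bijective c₂ (coproductIsCoproduct _) (X i₀) (hX i₀)).1

/-- "… in particular, a nonempty object of `C` is connected if and only if it is quasi-connected"
(FrdI §0 p. 15; finitely connected type). [cite: MochizukiFrdI2008, §0 p.15] -/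
theorem IsOfFinitelyConnectedType.isConnectedObj_iff (hC : IsOfFinitelyConnectedType C) {A : C}
    (hA : IsNonemptyObj A) : IsConnectedObj A ↔ IsQuasiConnected A :=
  ⟨Or.inr, fun h => h.elim (fun h' => absurd (hC.isMobile hA) h') id⟩

/-- "… in particular, a nonempty object of `C` is connected if and only if it is quasi-connected"
(FrdI §0 p. 15; countably connected type). [cite: MochizukiFrdI2008, §0 p.15] -/
theorem IsOfCountablyConnectedType.isConnectedObj_iff (hC : IsOfCountablyConnectedType C) {A : C}
    (hA : IsNonemptyObj A) : IsConnectedObj A ↔ IsQuasiConnected A :=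
  ⟨Or.inr, fun h => h.elim (fun h' => absurd (hC.isMobile hA) h') id⟩

/-- "If a mobile object `A` satisfies the condition that every morphism whose domain is nonempty and
whose codomain is `A` is an epimorphism, then `A` is connected" (FrdI §0 p. 15, with the bracketed
proof). [cite: MochizukiFrdI2008, §0 p.15] -/
theorem IsMobile.isConnectedObj {A : C} (hA : IsMobile A)
    (hepi : ∀ {X : C} (f : X ⟶ A), IsNonemptyObj X → Epi f) : IsConnectedObj A := by
  refine ⟨hA.isNonemptyObj, fun B₁ B₂ ι₁ ι₂ hB₁ hB₂ => ⟨fun hc => ?_⟩⟩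
  obtain ⟨B, f, g, hfg⟩ := hA
  apply hfg
  -- the arrow `l : A → B` agreeing with `f` on `B₁` and with `g` on `B₂` equals both `f` and `g`
  haveI := hepi ι₁ hB₁
  haveI := hepi ι₂ hB₂
  obtain ⟨l, hl₁, hl₂⟩ := BinaryCofan.IsColimit.desc' hc (ι₁ ≫ f) (ι₂ ≫ g)
  have h₁ : ι₁ ≫ l = ι₁ ≫ f := hl₁
  have h₂ : ι₂ ≫ l = ι₂ ≫ g := hl₂
  rw [← (cancel_epi ι₁).mp h₁, ← (cancel_epi ι₂).mp h₂]

/-- "In particular, it follows that if `C` is a totally epimorphic category, then every object of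
`C` is quasi-connected" (FrdI §0 p. 15). [cite: MochizukiFrdI2008, §0 p.15] -/
theorem IsTotallyEpimorphic.isQuasiConnected (hC : IsTotallyEpimorphic C) (A : C) :
    IsQuasiConnected A := by
  by_cases hA : IsMobile A
  · exact Or.inr (hA.isConnectedObj fun f _ => hC.epi f)
  · exact Or.inl hA

/-! ### `C⁰`, `C^⊥`, `C^⊤` (p. 16) -/

variable (C) in
/-- The property "connected" as an `ObjectProperty`, so that `C⁰ ⊆ C` is its full subcategory
(FrdI §0 p. 16). [cite: MochizukiFrdI2008, §0 p.16] -/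
def connectedObjects : ObjectProperty C := fun A => IsConnectedObj A

variable (C) in
/-- `C⁰ ⊆ C`, the full subcategory of connected objects (FrdI §0 p. 16; the paper warns that
objects of `C⁰` need not be connected *as objects of `C⁰`*). [cite: MochizukiFrdI2008, §0 p.16] -/
abbrev ConnectedPart := (connectedObjects C).FullSubcategory

variable (C) in
/-- Finiteness of the index set of a formal coproduct: the object property cutting `C^⊥` out of
Mathlib's `FormalCoproduct C` (FrdI §0 p. 16). [cite: MochizukiFrdI2008, §0 p.16] -/
def finiteFormalCoproducts : ObjectProperty (FormalCoproduct.{w} C) := fun X => Finite X.I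

variable (C) in
/-- Countability of the index set of a formal coproduct: the object property cutting `C^⊤` out of
`FormalCoproduct C` (FrdI §0 p. 16). [cite: MochizukiFrdI2008, §0 p.16] -/
def countableFormalCoproducts : ObjectProperty (FormalCoproduct.{w} C) := fun X => Countable X.I

variable (C) in
/-- `C^⊥`: formal finite coproducts of objects of `C`, with
`Hom(∐ Aᵢ, ∐ Bⱼ) := ∏ᵢ ∐ⱼ Hom_C(Aᵢ, Bⱼ)` (FrdI §0 p. 16) — this `Hom` is definitionally that of
Mathlib's `FormalCoproduct` (a map of index sets plus componentwise arrows).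
[cite: MochizukiFrdI2008, §0 p.16] -/
abbrev FiniteCoproductCompletion := (finiteFormalCoproducts.{w} C).FullSubcategory

variable (C) in
/-- `C^⊤`: formal countable coproducts of objects of `C` (FrdI §0 p. 16).
[cite: MochizukiFrdI2008, §0 p.16] -/
abbrev CountableCoproductCompletion := (countableFormalCoproducts.{w} C).FullSubcategory

variable (C) in
/-- "Objects of `C` define … objects of `C^⊥`": the inclusion `C ⥤ C^⊥` (singleton index set)
(FrdI §0 p. 16). [cite: MochizukiFrdI2008, §0 p.16] -/
def toFiniteCoproductCompletion : C ⥤ FiniteCoproductCompletion.{w} C :=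
  ObjectProperty.lift _ (FormalCoproduct.incl C) fun _ => inferInstanceAs (Finite PUnit.{w + 1})

variable (C) in
/-- "Objects of `C` define … objects of `C^⊤`": the inclusion `C ⥤ C^⊤` (FrdI §0 p. 16).
[cite: MochizukiFrdI2008, §0 p.16] -/
def toCountableCoproductCompletion : C ⥤ CountableCoproductCompletion.{w} C :=
  ObjectProperty.lift _ (FormalCoproduct.incl C) fun _ => inferInstanceAs (Countable PUnit.{w + 1})

/-- The inclusion `C ⥤ C^⊥` is fully faithful on objects of `C`: it is `FormalCoproduct.incl`
followed by the full subcategory inclusion. [cite: MochizukiFrdI2008, §0 p.16] -/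
theorem toFiniteCoproductCompletion_ι :
    toFiniteCoproductCompletion.{w} C ⋙ (finiteFormalCoproducts C).ι = FormalCoproduct.incl C :=
  rfl

/-- "We observe in passing that if `C` is a totally epimorphic category, and `α ∘ β` is an
isomorphism, then `α`, `β` are isomorphisms" (FrdI §0 p. 16). [cite: MochizukiFrdI2008, §0 p.16] -/
theorem IsTotallyEpimorphic.isIso_of_isIso_comp (hC : IsTotallyEpimorphic C) {X Y Z : C}
    (β : X ⟶ Y) (α : Y ⟶ Z) [IsIso (β ≫ α)] : IsIso α ∧ IsIso β := by
  haveI : Epi β := hC.epi β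
  haveI : IsSplitMono β := IsSplitMono.mk' ⟨α ≫ inv (β ≫ α), by rw [← Category.assoc, IsIso.hom_inv_id]⟩
  haveI : IsIso β := isIso_of_epi_of_isSplitMono β
  refine ⟨?_, inferInstance⟩
  have : α = inv β ≫ (β ≫ α) := by simp
  rw [this]
  infer_instance

/-! ### The graph of a category; connected categories (p. 16) -/

variable (C) in
/-- `C` is *connected* if the graph `G(C)` (one vertex per object, one edge per arrow) is connected
(FrdI §0 p. 16): nonempty, and any two objects are joined by a zigzag of arrows.
[cite: MochizukiFrdI2008, §0 p.16] -/
@[mk_iff] structure IsGraphConnected : Prop where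
  /-- the graph has a vertex -/
  nonempty : Nonempty C
  /-- any two vertices are joined by a path of edges, traversed in either direction -/
  zigzag : ∀ X Y : C, Zigzag X Y

/-- Mochizuki's graph-connectedness is Mathlib's `IsConnected`. [cite: MochizukiFrdI2008, §0 p.16] -/
theorem isGraphConnected_iff_isConnected : IsGraphConnected C ↔ IsConnected C := by
  constructor
  · rintro ⟨⟨X⟩, h⟩
    haveI : Nonempty C := ⟨X⟩
    exact zigzag_isConnected h
  · intro h
    exact ⟨h.is_nonempty, isPreconnected_zigzag⟩

end Categories

end Literature.AlgebraicGeometry.Frobenioids
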